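/-
Copyright (c) 2026 the pub-hodgecm-mathlib formalisation cell (harness21).  Prover seat hodgecm-mathlib-F0P3a-p02 (g18): road «S3-ram» (LEAD F0P3a-plan (g13);
architect A-p16 (g32); junction pen F0P3a-p01 (g17), J-PACK v2 (f) isoceles wave), HYP-PLAN v1 node (V5) «ASSEMBLY» — the POOLING step; 2026-09-02.
-/
import Literature.NumberTheory.Rogawski1990.DepthZeroKappaTransferTypeOneRamifiedRootRegionLayers   -- ★ p847622 (this lineage): layers, `sum_eq_of_three_types`
import HarnessLib

/-!
# The ramified type-(1) `κ`-orbital integral: POOLING the per-vertex token counts of a HYPERBOLIC isoceles root region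
# (Kottwitz 1986 §3; Rogawski 1990 §4.9)

Topic `NumberTheory/Rogawski1990`; namespace `Literature.NumberTheory.Rogawski1990`.  THEOREMS ONLY (no definition, no instance, no notation, no named fact, no `sorry`);
kernel lane `--supports stmt-HodgeConjecture-24833`; imports ★ `DepthZeroKappaTransferTypeOneRamifiedRootRegionLayers` only — GENERIC finite bookkeeping, no lattice token.
Cell `pub/hodgecm-mathlib` (D-0151), crux H413; road «S3-ram» (count-neutral), P-1-ram organ A′ (ii) (a2), junction J-PACK v2 (F0P3a-p01 (g17)), ISO sockets S45 v4
(`F0/P3a/F0P3a-p02/g17/iso/JunctionSocketsS45.statementfirst.v4.F0P3ap02g17.lean` bc98a4a1) :46 `row_S45_hyperbolic`, HYP-PLAN v1 (F0P3a-p04 (g19)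
`F0/P3a/F0P3a-p04/g19/hyp/HYP-PLAN.v1.F0P3ap04g19.md` 94da2402) node **(V5) ASSEMBLY**.

THE MATHEMATICS.  In the hyperbolic isoceles configuration the root region `R` has `1 + 2q(1 + q + ⋯ + q^{s−1})` vertices, of which `2q^s` are END vertices (no region
grandchild) and the others (the ROOT and the INTERIOR vertices) number `N = 1 + 2q(1 + ⋯ + q^{s−2})`.  The three engine token counts of a region vertex (off-region
grandchildren with the E-, P-, M-token; ★ `strataCount_J₀_isoceles`'s `hPE hPP hPM` summands) take ONE value on the non-END vertices — `(0, q(q−1)[lock], q(q−1)[¬lock])`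
— and ONE value on the END vertices — `(q(1+β), q(q−2−β−τ)/… )`, recorded here through `2·count` to stay in `ℕ`: `E = q·2[BIG]`, `2P = q(q−3 ∣ q−1 ∣ q−1 ∣ q+1)` and
`2M = q(q−1 ∣ q+1 ∣ q−3 ∣ q−1)` in the four cases `(lock, BIG) = (1,1) ∣ (1,0) ∣ (0,1) ∣ (0,0)`.  THIS FILE adds them up: the three region sums are EXACTLY the right-hand
sides of the socket `row_S45_hyperbolic` (`q·[BIG]·4q^s`, `q·((q−1)N + q^s(q−3))`, … VERBATIM), for any Finset `sR`, END-predicate and value functions with these data.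
Pure `Finset` arithmetic (`3 ≤ q`, `1 ≤ s`); the lattice content is in the per-vertex organs (V1)–(V4) and the layer count (V3).
HONEST LABEL: HC_CM is proved only modulo the 2 remaining named inputs (hLiu418 24832, h413 24833) until rung 0 closes; nothing printed is asserted here (bookkeeping).

## References
* [Kottwitz1986] R. E. Kottwitz, *Base change for unit elements of Hecke algebras*, Compositio Math. 60 (1986), §3 (counting fixed lattices shell by shell).
* [Rogawski1990] J. D. Rogawski, *Automorphic Representations of Unitary Groups in Three Variables*, Ann. of Math. Stud. 123 (1990), §4.9 Prop. 4.9.1 pp. 54–56.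
-/

set_option autoImplicit false

open Finset

namespace Literature.NumberTheory.Rogawski1990

variable {V : Type*}

/-- **THE NON-END COUNT.**  If `#sR = 1 + 2qΣ_{i<s} qⁱ` and the END vertices number `2q^s` (`1 ≤ s`), the remaining vertices number `1 + 2qΣ_{i<s−1} qⁱ`.
[cite: Kottwitz1986, §3] [cite: Rogawski1990, §4.9 pp. 54–56] -/
theorem card_filter_not_end_of_card (sR : Finset V) (PEND : V → Prop) [DecidablePred PEND] (q s : ℕ) (hs : 1 ≤ s)
    (hcard : sR.card = 1 + 2 * q * ∑ i ∈ Finset.range s, q ^ i) (hend : (sR.filter fun v => PEND v).card = 2 * q ^ s) :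
    (sR.filter fun v => ¬ PEND v).card = 1 + 2 * q * ∑ i ∈ Finset.range (s - 1), q ^ i := by
  obtain ⟨s₀, rfl⟩ : ∃ s₀, s = s₀ + 1 := ⟨s - 1, by omega⟩
  have hsplit := Finset.card_filter_add_card_filter_not (s := sR) (fun v => PEND v)
  rw [hend, hcard, Finset.sum_range_succ] at hsplit
  rw [Nat.add_sub_cancel]
  have h2 : 2 * q ^ (s₀ + 1) = 2 * q * q ^ s₀ := by ring
  rw [h2, mul_add] at hsplit
  omega

/-- **POOLING THE E-, P-, M-TOKEN COUNTS OF A HYPERBOLIC ISOCELES REGION.**  For a Finset `sR` with `#sR = 1 + 2qΣ_{i<s} qⁱ`, an END predicate selecting `2q^s` of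
its elements, and three `ℕ`-valued functions taking the NON-END values `(0, q(q−1)[lock], q(q−1)[¬lock])` and the END values `E = q·2[BIG]`,
`2P = q·(q−3 ∣ q−1 ∣ q−1 ∣ q+1)`, `2M = q·(q−1 ∣ q+1 ∣ q−3 ∣ q−1)` (cases `(lock,BIG) = (1,1) ∣ (1,0) ∣ (0,1) ∣ (0,0)`; `3 ≤ q`, `1 ≤ s`), the three sums over `sR` are
the right-hand sides of the S45 socket `row_S45_hyperbolic` VERBATIM: `q·(4q^s [BIG])`, `q·((q−1)(1 + 2qΣ_{i<s−1}qⁱ) + q^s(q−3))` etc.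
[cite: Kottwitz1986, §3] [cite: Rogawski1990, §4.9 Prop. 4.9.1 pp. 54–56] -/
theorem sum_regionTokens_hyperbolic_pool (sR : Finset V) (PEND : V → Prop) [DecidablePred PEND] (q s : ℕ) (hq : 3 ≤ q) (hs : 1 ≤ s)
    (hcard : sR.card = 1 + 2 * q * ∑ i ∈ Finset.range s, q ^ i) (hend : (sR.filter fun v => PEND v).card = 2 * q ^ s)
    (lock BIG : Prop) [Decidable lock] [Decidable BIG] (fE fP fM : V → ℕ)
    (hE₁ : ∀ v ∈ sR, ¬ PEND v → fE v = 0)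
    (hP₁ : ∀ v ∈ sR, ¬ PEND v → fP v = q * (if lock then q - 1 else 0))
    (hM₁ : ∀ v ∈ sR, ¬ PEND v → fM v = q * (if lock then 0 else q - 1))
    (hE₂ : ∀ v ∈ sR, PEND v → fE v = q * (if BIG then 2 else 0))
    (hP₂ : ∀ v ∈ sR, PEND v → 2 * fP v = q * (if lock then (if BIG then q - 3 else q - 1) else (if BIG then q - 1 else q + 1)))
    (hM₂ : ∀ v ∈ sR, PEND v → 2 * fM v = q * (if lock then (if BIG then q - 1 else q + 1) else (if BIG then q - 3 else q - 1))) :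
    ∑ v ∈ sR, fE v = q * (if BIG then 4 * q ^ s else 0) ∧
    ∑ v ∈ sR, fP v = q * (if lock then (if BIG then (q - 1) * (1 + 2 * q * ∑ i ∈ Finset.range (s - 1), q ^ i) + q ^ s * (q - 3)
        else (q - 1) * (1 + 2 * q * ∑ i ∈ Finset.range (s - 1), q ^ i) + q ^ s * (q - 1)) else (if BIG then q ^ s * (q - 1) else q ^ s * (q + 1))) ∧
    ∑ v ∈ sR, fM v = q * (if lock then (if BIG then q ^ s * (q - 1) else q ^ s * (q + 1)) else (if BIG then (q - 1) * (1 + 2 * q * ∑ i ∈ Finset.range (s - 1), q ^ i)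
        + q ^ s * (q - 3) else (q - 1) * (1 + 2 * q * ∑ i ∈ Finset.range (s - 1), q ^ i) + q ^ s * (q - 1))) := by
  have hnot := card_filter_not_end_of_card sR PEND q s hs hcard hend
  -- split every sum along the END predicate; each part is a constant sum
  have hsplit : ∀ f : V → ℕ, ∑ v ∈ sR, f v = ∑ v ∈ sR.filter (fun v => ¬ PEND v), f v + ∑ v ∈ sR.filter (fun v => PEND v), f v := fun f => by
    rw [add_comm, Finset.sum_filter_add_sum_filter_not]
  have hconst₁ : ∀ (f : V → ℕ) (a : ℕ), (∀ v ∈ sR, ¬ PEND v → f v = a) →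
      ∑ v ∈ sR.filter (fun v => ¬ PEND v), f v = (1 + 2 * q * ∑ i ∈ Finset.range (s - 1), q ^ i) * a := fun f a h => by
    rw [Finset.sum_congr rfl (fun v hv => h v (Finset.mem_filter.1 hv).1 (Finset.mem_filter.1 hv).2), Finset.sum_const, smul_eq_mul, hnot]
  have hconst₂ : ∀ (f : V → ℕ) (a : ℕ), (∀ v ∈ sR, PEND v → 2 * f v = a) → ∑ v ∈ sR.filter (fun v => PEND v), f v = q ^ s * a := fun f a h => by
    apply Nat.eq_of_mul_eq_mul_left (show 0 < 2 by norm_num)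
    rw [Finset.mul_sum, Finset.sum_congr rfl (fun v hv => h v (Finset.mem_filter.1 hv).1 (Finset.mem_filter.1 hv).2), Finset.sum_const, smul_eq_mul, hend]
    ring
  have hconstE : ∑ v ∈ sR.filter (fun v => PEND v), fE v = 2 * q ^ s * (q * (if BIG then 2 else 0)) := by
    rw [Finset.sum_congr rfl (fun v hv => hE₂ v (Finset.mem_filter.1 hv).1 (Finset.mem_filter.1 hv).2), Finset.sum_const, smul_eq_mul, hend]
  have hP := hconst₂ fP _ hP₂
  have hM := hconst₂ fM _ hM₂
  rw [hsplit fE, hconst₁ fE 0 hE₁, hconstE, hsplit fP, hconst₁ fP _ hP₁, hP, hsplit fM, hconst₁ fM _ hM₁, hM]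
  -- get rid of the truncated subtractions: `q = q' + 3`, `s = s₀ + 1`; then the four sign cases are polynomial identities
  obtain ⟨q', rfl⟩ : ∃ q', q = q' + 3 := ⟨q - 3, by omega⟩
  obtain ⟨s₀, rfl⟩ : ∃ s₀, s = s₀ + 1 := ⟨s - 1, by omega⟩
  have e3 : q' + 3 - 3 = q' := by omega
  have e1 : q' + 3 - 1 = q' + 2 := by omega
  have es : s₀ + 1 - 1 = s₀ := by omega
  simp only [e3, e1, es]
  by_cases hl : lock <;> by_cases hb : BIG <;> simp only [hl, hb, if_true, if_false] <;> refine ⟨by ring, by ring, by ring⟩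

end Literature.NumberTheory.Rogawski1990
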